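import Summits.CriticalPhenomena.PercolationContinuityZ3.Theorems.PercNearOneGluingNoHeavyQuantFarFiveOneLeSix
import HarnessLib

/-!
# FAR (`Quant.FarRelayRow`) on at most SIX vertices: everything except the two cells without a bidegree-2 certificate

builds on p205010 (kernel theorem, internal audit signed; external expert review pending)

Support file (`--supports stmt-CriticalPhenomena-4575`), seat `prim-cert-1` (gen 9).  COMPUTATIONAL by inheritance (the certificate instances
use `native_decide`).  One wrap-up theorem, `TwoCopy.farp_of_card_le_six`: for `n ≤ 6` the FAR instance `(w, A, o, j)` holds UNLESS
`n = 6`, `o ∉ A` and `(|A|, j) ∈ {(3, 1), (5, 2)}` — the two cells (Z(3,2) with two Steiner vertices; five relays at layer 2) for which the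
two-copy LP is infeasible (kit j099102/j099271, j099101) and which remain OPEN here.  Ingredients: `farRelayRow_of_card_le_five` family
(`…QuantFarLeFive`), `farp_four_one_of_card_le_six` (`…QuantFarFourOneLeSix`), `farp_five_one_of_card_le_six`, `farp_five_two_of_mem_of_card_le_six`,
`farp_six_two_of_card_le_six` (`…QuantFarFiveOneLeSix`), and the elementary cells `FARp.zero`, `FARp.one_of_mem`, `FARp.of_card_le`.
Also the `Quant.FarRelayRow`-shaped form `farRelayRow_of_card_le_six_of_not_exceptional`.
[cite: KozmaNitzan2024, Lemma 2 (p. 6), Conjecture 3 (p. 15)] (context; FAR is this programme's statement).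
-/

namespace Summit.CriticalPhenomena.PercolationContinuityZ3.Theorems.TwoCopy

open Finset MeasureTheory
open Literature.Probability.Percolation Literature.Probability.LatticeModels
open scoped Classical

variable {n : ℕ}

/-- **FAR on at most six vertices, except the two uncertified cells.**  For `n ≤ 6` and every `(w, A, o, j)` that is NOT of the form
`n = 6 ∧ o ∉ A ∧ ((|A| = 3 ∧ j = 1) ∨ (|A| = 5 ∧ j = 2))`, the FAR instance `FARp w A o j` holds. [this work] -/
theorem farp_of_card_le_six (hn : n ≤ 6) (w : Sym2 (Fin n) → unitInterval) (A : Finset (Fin n)) (o : Fin n) (j : ℕ)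
    (hex : ¬ (n = 6 ∧ o ∉ A ∧ ((A.card = 3 ∧ j = 1) ∨ (A.card = 5 ∧ j = 2)))) : FARp w A o j := by
  have hAn : A.card ≤ n := by simpa using Finset.card_le_univ A
  rcases j with _ | j
  · exact FARp.zero w A o
  by_cases hAj : A.card ≤ 2 * (j + 1)
  · exact FARp.of_card_le w A o (j + 1) hAj
  rw [not_le] at hAj
  rcases j with _ | j
  · -- layer 1, `|A| ≥ 3`
    show FARp w A o 1
    by_cases hoA : o ∈ A
    · exact FARp.one_of_mem w A o hoA (by omega)
    have hAo : A.card + 1 ≤ n := by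
      have h := Finset.card_le_univ (insert o A)
      rw [Finset.card_insert_of_notMem hoA, Fintype.card_fin] at h
      exact h
    rcases (show A.card = 3 ∨ A.card = 4 ∨ A.card = 5 by omega) with h3 | h4 | h5
    · by_cases hn5 : n ≤ 5
      · exact farp_three_one_of_card_le_five hn5 w A o h3
      · exact absurd ⟨by omega, hoA, Or.inl ⟨h3, rfl⟩⟩ hex
    · exact farp_four_one_of_card_le_six hn w A o h4
    · exact farp_five_one_of_card_le_six hn w A o h5
  · rcases j with _ | j
    · -- layer 2, `|A| ≥ 5`
      show FARp w A o 2
      rcases (show A.card = 5 ∨ A.card = 6 by omega) with h5 | h6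
      · by_cases hoA : o ∈ A
        · exact farp_five_two_of_mem_of_card_le_six hn w A o hoA h5
        · have hAo : A.card + 1 ≤ n := by
            have h := Finset.card_le_univ (insert o A)
            rw [Finset.card_insert_of_notMem hoA, Fintype.card_fin] at h
            exact h
          exact absurd ⟨by omega, hoA, Or.inr ⟨h5, rfl⟩⟩ hex
      · exact farp_six_two_of_card_le_six hn w A o h6
    · exfalso
      omega

/-- `Quant.FarRelayRow` restricted to `n ≤ 6`, exact shape, outside the two uncertified cells. [this work] -/
theorem farRelayRow_of_card_le_six_of_not_exceptional (hn : n ≤ 6) (w : Sym2 (Fin n) → unitInterval) (A : Finset (Fin n))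
    (o : Fin n) (j : ℕ) (t : ℝ) (hex : ¬ (n = 6 ∧ o ∉ A ∧ ((A.card = 3 ∧ j = 1) ∨ (A.card = 5 ∧ j = 2))))
    (hEN : (2 * j : ℝ) < ∑ a ∈ A, (prodBernoulli w).real (openConn o a))
    (hcut : ∀ a ∈ A, (prodBernoulli w).real (openConn o a)ᶜ ≤ t) :
    (prodBernoulli w).real {ω : BondConfig (Fin n) | (A.filter fun a => ω ∈ openConn o a).card ≤ j} ≤ t :=
  farp_of_card_le_six hn w A o j hex hEN t hcut

end Summit.CriticalPhenomena.PercolationContinuityZ3.Theorems.TwoCopy
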